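import Summits.SmoothPoincare4.SmoothPoincare4.Theses.EntropyRung
import Summits.SmoothPoincare4.SmoothPoincare4.Theorems.EntropyRungSubcylindricalExistenceScalarPositiveUpgradeGroundState
import Summits.SmoothPoincare4.SmoothPoincare4.Theorems.EntropyRungSubcylindricalExistenceWeightComparison
import Literature.Geometry.Lorentzian.DalembertianCompose
import Literature.Geometry.Lorentzian.ChartLaplacian
import Literature.Geometry.Riemannian.PerelmanEntropyCutoff
import HarnessLib

/-!
# The conformal nudge `ψ_t = (1 + t φ)/(1 + t max φ)²` by the ground state of the conformal
# Laplacian and its weighted `𝒲`-clause at every scale (aux for stub `stub_scalarPositiveUpgrade`,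
# line `fat-conical-core-avr-logsobolev`, crux `EntropyRung.SubcylindricalExistence`, stmt-SmoothPoincare4-10871)

Let `G` be a Riemannian metric (Levi-Civita) on a closed smooth `4`-manifold of the summit binder,
`R = R_G ≥ 0`, and `φ > 0` smooth with `R φ − 6 Δ_G φ = λ φ`, `λ > 0` (the positive ground state of
`helper_stub_scalarPositiveUpgrade_groundState`), `φ ≤ Φ`, `φ ≥ φ_min > 0`, `|∇φ|²_G ≤ C`. For
`0 < t`, `t Φ ≤ 1`, put `P = 1 + tΦ`, `A = P⁻²` and `ψ = A (1 + t φ)`. Then (registered helper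
`helper_stub_scalarPositiveUpgrade_factor`): `ψ` is smooth, `0 < ψ ≤ 1`,
`L_G ψ = R ψ − 6 Δ_G ψ = A (R + t λ φ) > 0`, and if the crux's `e^{-f}`-clause of `G` holds at level
`L` at every scale then for every `0 < ε' < 1` the `ψ`-weighted `w²`-clause (weights `ψ⁴ dV_G`,
curvature `ψ⁻³ L_G ψ`, gradient `ψ⁻²|∇w|²`) holds at EVERY scale at level
`L + 2 log(1 − ε') − 16 tΦ − 512 t (C+1)² / (ε' λ φ_min)`.

Proof: the weight-comparison lemma H3 `wClause_weight_comparison` with `φ₀ = 1`, `φ₁ = ψ`,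
`r₀ = R`, `r₁ = ψ⁻³ L_G ψ ≥ R` (because `ψ³ ≤ A`, this is why `ψ` is normalised by `P⁻²`; so
`κ'' = 0`), `κ = log P²`, `κ' = t (C+1)` (`|∇ log ψ|² = t²|∇φ|²/(1+tφ)² ≤ t² C`), gives the clause
at level `L + 2 log(1−ε') − 8κ − 16 τ e^{2κ} κ'²/ε'`, a loss linear in `τ`; the curvature weight has
the floor `r₁ ≥ a = t λ φ_min > 0`, so `allScales_of_linearLoss` (H11) freezes the loss at
`τ₀ = 2/a`, and `8κ ≤ 16 tΦ`, `16 e^{2κ} κ'² (2/a)/ε' = 32 P⁴ t (C+1)²/(ε' λ φ_min) ≤ 512 t (C+1)²/(ε' λ φ_min)`.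
Everything is proved; no definition, no named fact.

References: G. Perelman, arXiv:math/0211159, §3.1 [Perelman2002Entropy]; T. Aubin, *Nonlinear
Analysis on Manifolds* (1982), Ch. 6, §6.3 (conformal Laplacian in dimension four) [Aubin1982].
-/

noncomputable section

-- the registered namespace `Summit.SmoothPoincare4.SmoothPoincare4.Theorems` repeats a component
set_option linter.dupNamespace false

open scoped Manifold ContDiff Topology ENNReal NNReal
open Set Filter MeasureTheory
open Literature.Geometry.Lorentzian Literature.Geometry.Riemannian

namespace Summit.SmoothPoincare4.SmoothPoincare4.Theorems

namespace ScalarPositiveUpgradeAux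

variable {M : Type} [TopologicalSpace M]
  [ChartedSpace (EuclideanSpace ℝ (Fin 4)) M] [IsManifold (𝓡 4) ∞ M]
  (G : PseudoRiemannianMetric (𝓡 4) ∞ (EuclideanSpace ℝ (Fin 4)) (TangentSpace (𝓡 4) : M → Type _))
  [G.HasLeviCivita]

/-! ### Pointwise calculus of the affine factor `A (1 + t φ)` -/

/-- `Δ_G (A (1 + t φ)) = A t Δ_G φ` (chain rule `dalembertian_real_comp` with an affine profile). -/
theorem dalembertian_affine_factor {φ : M → ℝ} {x : M} (hφ : ContMDiffAt (𝓡 4) 𝓘(ℝ, ℝ) 2 φ x)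
    (A t : ℝ) : G.dalembertian (fun y ↦ A * (1 + t * φ y)) x = A * t * G.dalembertian φ x := by
  have hζ : ContDiffAt ℝ 2 (fun s : ℝ ↦ A * (1 + t * s)) (φ x) :=
    (contDiff_const.mul (contDiff_const.add (contDiff_const.mul contDiff_id))).contDiffAt
  have hd : deriv (fun s : ℝ ↦ A * (1 + t * s)) = fun _ ↦ A * t := by
    funext s
    have h : HasDerivAt (fun s : ℝ ↦ A * (1 + t * s)) (A * (t * 1)) s :=
      (((hasDerivAt_id s).const_mul t).const_add 1).const_mul A
    rw [mul_one] at h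
    exact h.deriv
  have hdd : deriv (deriv (fun s : ℝ ↦ A * (1 + t * s))) = fun _ ↦ 0 := by
    rw [hd]; funext s; exact deriv_const s _
  have key := G.dalembertian_real_comp hφ hζ
  rw [hdd, hd] at key
  rw [show (fun y ↦ A * (1 + t * φ y)) = (fun s : ℝ ↦ A * (1 + t * s)) ∘ φ from rfl, key]
  ring

omit [G.HasLeviCivita] in
/-- `|∇(A (1 + t φ))|²_G = (A t)² |∇φ|²_G`. -/
theorem gradSq_affine_factor {φ : M → ℝ} {x : M} (hφ : MDifferentiableAt (𝓡 4) 𝓘(ℝ, ℝ) φ x)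
    (A t : ℝ) : G.gradSq (fun y ↦ A * (1 + t * φ y)) x = (A * t) ^ 2 * G.gradSq φ x := by
  have hd : HasDerivAt (fun s : ℝ ↦ A * (1 + t * s)) (A * (t * 1)) (φ x) :=
    (((hasDerivAt_id (φ x)).const_mul t).const_add 1).const_mul A
  rw [mul_one] at hd
  rw [show (fun y ↦ A * (1 + t * φ y)) = (fun s : ℝ ↦ A * (1 + t * s)) ∘ φ from rfl,
    G.gradSq_real_comp hd hφ]

omit [G.HasLeviCivita] in
/-- `|∇ log(ψ/1)|²_G = ψ⁻² |∇ψ|²_G` at a point where `ψ > 0`. -/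
theorem gradSq_log_div_one {ψ : M → ℝ} {x : M} (hψ : MDifferentiableAt (𝓡 4) 𝓘(ℝ, ℝ) ψ x)
    (hpos : 0 < ψ x) : G.gradSq (fun y ↦ Real.log (ψ y / 1)) x = (ψ x)⁻¹ ^ 2 * G.gradSq ψ x := by
  have hd : HasDerivAt (fun s : ℝ ↦ Real.log (s / 1)) (ψ x)⁻¹ (ψ x) := by
    simpa using Real.hasDerivAt_log hpos.ne'
  rw [show (fun y ↦ Real.log (ψ y / 1)) = (fun s : ℝ ↦ Real.log (s / 1)) ∘ ψ from rfl,
    G.gradSq_real_comp hd hψ]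

/-! ### Two scalar inequalities -/

/-- `t² C ≤ (t (C+1))²` for `C ≥ 0`. -/
theorem sq_mul_le_sq_mul_add_one_sq (t : ℝ) {C : ℝ} (hC : 0 ≤ C) : t ^ 2 * C ≤ (t * (C + 1)) ^ 2 := by
  have h1 : 0 ≤ (C + 1) ^ 2 - C := by nlinarith [sq_nonneg C]
  nlinarith [mul_nonneg (sq_nonneg t) h1]

/-- The frozen loss: `16 P⁴ (t(C+1))²/ε' · (2/(t λ φ_min)) ≤ 512 t (C+1)²/(ε' λ φ_min)` for
`0 < P ≤ 2`. -/
theorem frozen_loss_le {P t C ε' lam φmin : ℝ} (hP0 : 0 < P) (hP2 : P ≤ 2) (ht : 0 < t)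
    (hε' : 0 < ε') (hlam : 0 < lam) (hφmin : 0 < φmin) :
    16 * P ^ 4 * (t * (C + 1)) ^ 2 / ε' * (2 / (t * lam * φmin)) ≤
      512 * t * (C + 1) ^ 2 / (ε' * lam * φmin) := by
  have hP4 : P ^ 4 ≤ 16 := by
    have h := pow_le_pow_left₀ hP0.le hP2 4
    norm_num at h
    exact h
  have e : 16 * P ^ 4 * (t * (C + 1)) ^ 2 / ε' * (2 / (t * lam * φmin)) =
      32 * P ^ 4 * t * (C + 1) ^ 2 / (ε' * lam * φmin) := by
    rw [div_mul_div_comm, div_eq_div_iff (by positivity) (by positivity)]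
    ring
  rw [e]
  refine div_le_div_of_nonneg_right ?_ (by positivity)
  have h0 : 0 ≤ 32 * t * (C + 1) ^ 2 := by positivity
  nlinarith [mul_le_mul_of_nonneg_right hP4 h0]

end ScalarPositiveUpgradeAux

open ScalarPositiveUpgradeAux in
/-- **Registered helper `helper_stub_scalarPositiveUpgrade_factor`** (aux for stub
`stub_scalarPositiveUpgrade`): the conformal nudge `ψ = (1 + tφ)/(1 + tΦ)²` by the positive ground
state `φ` of the conformal Laplacian is smooth, positive, has `L_G ψ > 0`, and carries the crux's
clause of `G` (level `L`, all scales) to the `ψ`-weighted `w²`-clause at every scale at level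
`L + 2 log(1 − ε') − 16 tΦ − 512 t (C+1)²/(ε' λ φ_min)`. See the module docstring.
[cite: Perelman2002Entropy, §3.1] -/
theorem helper_stub_scalarPositiveUpgrade_factor :
    ∀ (M : Type) [TopologicalSpace M] [T2Space M] [SecondCountableTopology M]
    [ChartedSpace (EuclideanSpace ℝ (Fin 4)) M] [IsManifold (𝓡 4) ∞ M] [CompactSpace M]
    [T3Space M] [MeasurableSpace M] [BorelSpace M]
    (G : PseudoRiemannianMetric (𝓡 4) ∞ (EuclideanSpace ℝ (Fin 4)) (TangentSpace (𝓡 4) : M → Type _))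
    [G.HasLeviCivita] (hG : G.IsRiemannian) (φ : M → ℝ) (lam Φ φmin C L ε' t : ℝ),
    ContMDiff (𝓡 4) 𝓘(ℝ, ℝ) ∞ φ → (∀ x : M, 0 < φ x) → 0 < lam →
    (∀ x : M, G.scalarCurvature x * φ x - 6 * G.dalembertian φ x = lam * φ x) →
    (∀ x : M, 0 ≤ G.scalarCurvature x) → 0 ≤ Φ → (∀ x : M, φ x ≤ Φ) → 0 < φmin →
    (∀ x : M, φmin ≤ φ x) → 0 ≤ C → (∀ x : M, G.gradSq φ x ≤ C) →
    (∀ τ : ℝ, 0 < τ → ∀ f : M → ℝ, ContMDiff (𝓡 4) 𝓘(ℝ, ℝ) ∞ f →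
      ∫ x, (4 * Real.pi * τ) ^ (-(4 : ℝ) / 2) * Real.exp (-f x)
          ∂(riemannianMeasure (G.toContMDiffRiemannianMetric hG)) = 1 →
        L ≤ ∫ x, (τ * (G.scalarCurvature x + G.gradSq f x) + f x - 4) *
          ((4 * Real.pi * τ) ^ (-(4 : ℝ) / 2) * Real.exp (-f x))
          ∂(riemannianMeasure (G.toContMDiffRiemannianMetric hG))) →
    0 < ε' → ε' < 1 → 0 < t → t * Φ ≤ 1 →
    ∃ ψ : M → ℝ, ContMDiff (𝓡 4) 𝓘(ℝ, ℝ) ∞ ψ ∧ (∀ x : M, 0 < ψ x) ∧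
      (∀ x : M, 0 < G.scalarCurvature x * ψ x - 6 * G.dalembertian ψ x) ∧
      ∀ τ : ℝ, 0 < τ → ∀ w : M → ℝ, ContMDiff (𝓡 4) 𝓘(ℝ, ℝ) ∞ w →
        ∫ x, (4 * Real.pi * τ) ^ (-(4 : ℝ) / 2) * (w x) ^ 2 * (ψ x) ^ 4
            ∂(riemannianMeasure (G.toContMDiffRiemannianMetric hG)) = 1 →
          L + 2 * Real.log (1 - ε') - 16 * t * Φ - 512 * t * (C + 1) ^ 2 / (ε' * lam * φmin) ≤
            ∫ x, (τ * ((ψ x ^ 3)⁻¹ * (G.scalarCurvature x * ψ x - 6 * G.dalembertian ψ x) * (w x) ^ 2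
                + 4 * ((ψ x)⁻¹ ^ 2 * G.gradSq w x))
              - (w x) ^ 2 * Real.log ((w x) ^ 2) - 4 * (w x) ^ 2)
              * ((4 * Real.pi * τ) ^ (-(4 : ℝ) / 2) * (ψ x) ^ 4)
            ∂(riemannianMeasure (G.toContMDiffRiemannianMetric hG)) := by
  intro M _ _ _ _ _ _ _ _ _ G _ hG φ lam Φ φmin C L ε' t hφ hφpos hlam heq hR0 hΦ0 hΦ hφmin hφmin' hC0 hC
    hclause hε' hε'1 ht htΦ
  -- the constants `P = 1 + tΦ`, `A = P⁻²`
  set P : ℝ := 1 + t * Φ with hP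
  have hP1 : 1 ≤ P := by rw [hP]; nlinarith [mul_nonneg ht.le hΦ0]
  have hP0 : 0 < P := by linarith
  have hP2 : P ≤ 2 := by rw [hP]; linarith
  set A : ℝ := (P ^ 2)⁻¹ with hA
  have hA0 : 0 < A := by positivity
  have hAP : A * P = P⁻¹ := by rw [hA]; field_simp
  -- the factor
  set ψ : M → ℝ := fun x ↦ A * (1 + t * φ x) with hψ
  have h1φ : ∀ x, 1 ≤ 1 + t * φ x := fun x ↦ by have := mul_pos ht (hφpos x); linarith
  have hψpos : ∀ x, 0 < ψ x := fun x ↦ mul_pos hA0 (by linarith [h1φ x])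
  have hψA : ∀ x, A ≤ ψ x := fun x ↦ le_mul_of_one_le_right hA0.le (h1φ x)
  have hψP : ∀ x, ψ x ≤ P⁻¹ := fun x ↦ by
    rw [← hAP]
    exact mul_le_mul_of_nonneg_left (by rw [hP]; nlinarith [mul_le_mul_of_nonneg_left (hΦ x) ht.le]) hA0.le
  have hψ1 : ∀ x, ψ x ≤ 1 := fun x ↦ (hψP x).trans (inv_le_one_of_one_le₀ hP1)
  have hψ3A : ∀ x, ψ x ^ 3 ≤ A := fun x ↦ by
    calc ψ x ^ 3 ≤ P⁻¹ ^ 3 := pow_le_pow_left₀ (hψpos x).le (hψP x) 3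
      _ = (P ^ 3)⁻¹ := by rw [inv_pow]
      _ ≤ (P ^ 2)⁻¹ := inv_anti₀ (by positivity) (pow_le_pow_right₀ hP1 (by norm_num))
  have hψs : ContMDiff (𝓡 4) 𝓘(ℝ, ℝ) ∞ ψ :=
    contMDiff_const.mul (contMDiff_const.add (contMDiff_const.mul hφ))
  have hψ2 : ContMDiff (𝓡 4) 𝓘(ℝ, ℝ) 2 ψ := hψs.of_le (WithTop.coe_le_coe.mpr le_top)
  -- `L_G ψ = A (R + t λ φ) > 0`
  have hLψ : ∀ x, G.scalarCurvature x * ψ x - 6 * G.dalembertian ψ x =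
      A * (G.scalarCurvature x + t * lam * φ x) := fun x ↦ by
    have hφ2 : ContMDiffAt (𝓡 4) 𝓘(ℝ, ℝ) 2 φ x := (hφ x).of_le (WithTop.coe_le_coe.mpr le_top)
    rw [show G.dalembertian ψ x = A * t * G.dalembertian φ x from dalembertian_affine_factor G hφ2 A t]
    simp only [hψ]
    linear_combination A * t * heq x
  have hLψpos : ∀ x, 0 < G.scalarCurvature x * ψ x - 6 * G.dalembertian ψ x := fun x ↦ by
    rw [hLψ x]; have := hR0 x; have := hφpos x; positivity
  -- the curvature weight `r = ψ⁻³ L_G ψ ≥ R`, floor `t λ φ_min`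
  set r : M → ℝ := fun x ↦ (ψ x ^ 3)⁻¹ * (G.scalarCurvature x * ψ x - 6 * G.dalembertian ψ x) with hr
  have hRc : Continuous G.scalarCurvature := G.contMDiff_scalarCurvature.continuous
  have hrc : Continuous r := by
    have hΔc : Continuous (G.dalembertian ψ) := continuous_dalembertian G hψ2
    exact ((hψs.continuous.pow 3).inv₀ fun x ↦ (pow_pos (hψpos x) 3).ne').mul
      ((hRc.mul hψs.continuous).sub (continuous_const.mul hΔc))
  have hr_of : ∀ x (b : ℝ), b * ψ x ^ 3 ≤ A * (G.scalarCurvature x + t * lam * φ x) → b ≤ r x := by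
    intro x b hb
    have h3 : 0 < ψ x ^ 3 := pow_pos (hψpos x) 3
    calc b = (ψ x ^ 3)⁻¹ * (b * ψ x ^ 3) := by
          rw [mul_comm b, ← mul_assoc, inv_mul_cancel₀ h3.ne', one_mul]
      _ ≤ (ψ x ^ 3)⁻¹ * (A * (G.scalarCurvature x + t * lam * φ x)) :=
          mul_le_mul_of_nonneg_left hb (inv_pos.2 h3).le
      _ = r x := by simp only [hr, hLψ x]
  have hrR : ∀ x, G.scalarCurvature x ≤ r x := fun x ↦ hr_of x _ (by
    have h1 := mul_le_mul_of_nonneg_left (hψ3A x) (hR0 x)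
    have h2 : 0 ≤ A * (t * lam * φ x) := by have := hφpos x; positivity
    nlinarith)
  have hra : ∀ x, t * lam * φmin ≤ r x := fun x ↦ hr_of x _ (by
    have h1 := mul_le_mul_of_nonneg_left (hψ3A x) (by positivity : 0 ≤ t * lam * φmin)
    have h2 := mul_le_mul_of_nonneg_left (hφmin' x) (by positivity : 0 ≤ A * (t * lam))
    have h3 : 0 ≤ A * G.scalarCurvature x := mul_nonneg hA0.le (hR0 x)
    nlinarith)
  -- the comparison constants `κ = log P²`, `κ' = t (C+1)`, `κ'' = 0`
  set κ : ℝ := Real.log (P ^ 2) with hκ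
  have hP21 : 1 ≤ P ^ 2 := one_le_pow₀ hP1
  have hκ0 : 0 ≤ κ := Real.log_nonneg hP21
  have hexpκ : Real.exp κ = P ^ 2 := Real.exp_log (by positivity)
  have hexpnκ : Real.exp (-κ) = A := by rw [Real.exp_neg, hexpκ]
  set κ' : ℝ := t * (C + 1) with hκ'
  have hκ'0 : 0 ≤ κ' := by positivity
  have hρ : ∀ x ∈ univ, Real.exp (-κ) ≤ ψ x / 1 ∧ ψ x / 1 ≤ Real.exp κ := fun x _ ↦ by
    rw [div_one, hexpnκ, hexpκ]
    exact ⟨hψA x, (hψ1 x).trans hP21⟩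
  have hΛ : ∀ x ∈ univ, (1 : ℝ)⁻¹ ^ 2 * G.gradSq (fun y ↦ Real.log (ψ y / 1)) x ≤ κ' ^ 2 := by
    intro x _
    have hφx : MDifferentiableAt (𝓡 4) 𝓘(ℝ, ℝ) φ x := (hφ x).mdifferentiableAt (by simp)
    have hψx : MDifferentiableAt (𝓡 4) 𝓘(ℝ, ℝ) ψ x := (hψs x).mdifferentiableAt (by simp)
    have hq : (ψ x)⁻¹ * (A * t) = t / (1 + t * φ x) := by
      have hA' : A ≠ 0 := hA0.ne'
      rw [show ψ x = A * (1 + t * φ x) from rfl, div_eq_mul_inv, mul_inv, mul_comm A⁻¹, mul_assoc,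
        ← mul_assoc A⁻¹, inv_mul_cancel₀ hA', one_mul, mul_comm ((1 + t * φ x)⁻¹) t]
    have hq0 : 0 ≤ t / (1 + t * φ x) := by have := h1φ x; positivity
    have hq1 : t / (1 + t * φ x) ≤ t := div_le_self ht.le (h1φ x)
    have hG0 : 0 ≤ G.gradSq φ x := G.gradSq_nonneg hG φ x
    rw [inv_one, one_pow, one_mul, gradSq_log_div_one G hψx (hψpos x),
      show G.gradSq ψ x = (A * t) ^ 2 * G.gradSq φ x from gradSq_affine_factor G hφx A t,
      show (ψ x)⁻¹ ^ 2 * ((A * t) ^ 2 * G.gradSq φ x) = ((ψ x)⁻¹ * (A * t)) ^ 2 * G.gradSq φ x by ring,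
      hq]
    calc (t / (1 + t * φ x)) ^ 2 * G.gradSq φ x ≤ t ^ 2 * C :=
          mul_le_mul (pow_le_pow_left₀ hq0 hq1 2) (hC x) hG0 (sq_nonneg t)
      _ ≤ κ' ^ 2 := sq_mul_le_sq_mul_add_one_sq t hC0
  have hrH : ∀ x ∈ univ, 0 ≤ G.scalarCurvature x ∧ G.scalarCurvature x - 0 ≤ r x :=
    fun x _ ↦ ⟨hR0 x, by rw [sub_zero]; exact hrR x⟩
  -- H3: the `ψ`-clause with a loss linear in the scale
  have hH3 := wClause_weight_comparison M G hG univ isOpen_univ (fun _ ↦ (1 : ℝ)) ψ G.scalarCurvature r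
    contMDiffOn_const hψs.contMDiffOn hRc.continuousOn hrc.continuousOn (fun _ _ ↦ one_pos)
    (fun x _ ↦ hψpos x) κ κ' 0 hκ0 hκ'0 le_rfl hρ hΛ hrH L (wClause_weight_one G hG hclause)
  set μ : Measure M := riemannianMeasure (G.toContMDiffRiemannianMetric hG) with hμ
  set B : ℝ := 16 * Real.exp (2 * κ) * κ' ^ 2 / ε' with hB
  have hB0 : 0 ≤ B := by positivity
  have ha0 : 0 < t * lam * φmin := by positivity
  have hlin : ∀ τ : ℝ, 0 < τ → ∀ w : M → ℝ, ContMDiff (𝓡 4) 𝓘(ℝ, ℝ) ∞ w →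
      ∫ x, (4 * Real.pi * τ) ^ (-(4 : ℝ) / 2) * (w x) ^ 2 * (ψ x) ^ 4 ∂μ = 1 →
        (L + 2 * Real.log (1 - ε') - 8 * κ) - B * τ ≤
          ∫ x, (τ * (r x * (w x) ^ 2 + 4 * ((ψ x)⁻¹ ^ 2 * G.gradSq w x))
            - (w x) ^ 2 * Real.log ((w x) ^ 2) - 4 * (w x) ^ 2)
            * ((4 * Real.pi * τ) ^ (-(4 : ℝ) / 2) * (ψ x) ^ 4) ∂μ := by
    intro τ hτ w hw hn
    have h := hH3 τ ε' hτ hε' hε'1 w hw (subset_univ _) hn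
    have e : B * τ = 16 * τ * Real.exp (2 * κ) * κ' ^ 2 / ε' := by rw [hB]; ring
    linarith
  -- freeze the loss at `τ₀ = 2/(t λ φ_min)` (H11)
  have hall := allScales_of_linearLoss G hG hψs hψpos hrc ha0 hra hB0 hlin
  -- the level
  have hκle : κ ≤ 2 * (t * Φ) := by
    have h1 := Real.log_le_sub_one_of_pos hP0
    rw [hκ, Real.log_pow, Nat.cast_ofNat]
    have h2 : P - 1 = t * Φ := by rw [hP]; ring
    linarith
  have hexp2 : Real.exp (2 * κ) = P ^ 4 := by rw [two_mul, Real.exp_add, hexpκ]; ring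
  have hBa : B * (2 / (t * lam * φmin)) ≤ 512 * t * (C + 1) ^ 2 / (ε' * lam * φmin) := by
    rw [hB, hexp2, hκ']
    exact frozen_loss_le hP0 hP2 ht hε' hlam hφmin
  have hlevel : L + 2 * Real.log (1 - ε') - 16 * t * Φ - 512 * t * (C + 1) ^ 2 / (ε' * lam * φmin) ≤
      (L + 2 * Real.log (1 - ε') - 8 * κ) - B * (2 / (t * lam * φmin)) := by
    linarith
  exact ⟨ψ, hψs, hψpos, hLψpos, fun τ hτ w hw hn ↦ hlevel.trans (hall τ hτ w hw hn)⟩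

end Summit.SmoothPoincare4.SmoothPoincare4.Theorems

end
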